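import Mathlib.Probability.Distributions.Gaussian.Multivariate
import Mathlib.MeasureTheory.Integral.Pi
import Mathlib.Topology.Algebra.MvPolynomial
import Mathlib.Algebra.MvPolynomial.Monad
import Mathlib.Algebra.MvPolynomial.Eval
import Mathlib.Algebra.MvPolynomial.Degrees
import Mathlib.Algebra.MvPolynomial.Rename
import Literature.Probability.Distributions.GaussianMoments
import Literature.Probability.Distributions.RademacherEvenMoments
import Literature.Computability.Complexity.FourierDegreeAlgebra
import HarnessLib

/-!
# Gaussian hypercontractivity for polynomials (Bonami–Nelson–Gross, even-moment form)

Let `γₙ = 𝒩(0,1)^{⊗n}` be the standard Gaussian measure on `ℝⁿ`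
(`Measure.pi fun _ => gaussianReal 0 1`) and `P` a real polynomial in `n` variables of total
degree at most `d`. Then for every integer `r ≥ 1`

  `∫ P^{2r} dγₙ ≤ (2r - 1)^{rd} (∫ P² dγₙ)^r`,  i.e.  `‖P‖_{L^{2r}(γₙ)} ≤ (2r-1)^{d/2} ‖P‖_{L²(γₙ)}`

(`gaussian_bonami_pi`, and `gaussian_bonami_pi'` for an arbitrary finite index type; linear images
`z ↦ A z`, i.e. ARBITRARY CENTRED GAUSSIAN VECTORS including singular covariances, in
`gaussian_bonami_mulVec`, and Mathlib's `multivariateGaussian 0 S` in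
`gaussian_bonami_multivariateGaussian`). This is
Nelson's hypercontractive inequality restricted to polynomials of degree `≤ d`
(Janson 1997, Thm. 5.10 / Remark 5.11: `‖X‖_q ≤ (q-1)^{d/2} ‖X‖₂` for `X` in the sum of the first
`d` chaoses; Nelson 1973; for the cube Bonami 1970), in the even-moment form that constructive
field theory uses to bound `L^q`-norms of Wick polynomials by `q^{deg/2}` times their `L²`-norms
(Glimm–Jaffe §8.6; Simon, *The `P(φ)₂` Euclidean QFT*, §I.5).

Proof (Gross 1975, §4: "two-point space ⇒ Gauss space by the central limit theorem"): realise each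
Gaussian coordinate as a limit of normalised Rademacher sums `k^{-1/2} ∑_{j<k} (-1)^{x_{ij}}` on the
cube `{0,1}^{nk}`; the pulled-back polynomial is a multilinear function of Fourier level `≤ d`
(`isLevelLE_embedEval`, degree algebra of `FourierDegreeAlgebra.lean`), so the tree's cube Bonami
lemma `bonami_even_moment` applies at every `k`; both sides are finite linear combinations of
products of moments of `S_k/√k`, which converge to the Gaussian moments
(`RademacherEvenMoments.tendsto_radMomentN`), and the inequality passes to the limit. Only moment
convergence is used (no weak convergence).

No definitions of mathematical content (the two `def`s are the bookkeeping embedding); no named facts.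

## References

* E. Nelson, *The free Markoff field*, J. Funct. Anal. 12 (1973) 211–227 (hypercontractivity).
  [Nelson1973]
* L. Gross, *Logarithmic Sobolev inequalities*, Amer. J. Math. 97 (1975) 1061–1083, §4. [Gross1975]
* A. Bonami, *Étude des coefficients de Fourier des fonctions de `L^p(G)`*, Ann. Inst. Fourier 20
  (1970) 335–402. [Bonami1970]
* S. Janson, *Gaussian Hilbert Spaces*, Cambridge Tracts 129 (1997), Thm. 5.10, Rem. 5.11,
  Thm. 3.50. [Janson1997]
* R. O'Donnell, *Analysis of Boolean Functions*, CUP 2014, Thm. 9.21, §11.1. [ODonnell2014]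
-/

noncomputable section

namespace Literature.Probability.Distributions

open MeasureTheory ProbabilityTheory Finset Filter Topology MvPolynomial
open Literature.Probability.RandomGraphs.LowDegree Literature.Computability.Complexity.LowDegree
open scoped Nat Matrix MatrixOrder

/-! ### Moments of the standard Gaussian as the sequence `gaussMoment` -/

/-- `∫ x^q d𝒩(0,1) = gaussMoment q` (`(q-1)‼` for even `q`, `0` for odd `q`). [cite: Janson1997, Rem. 1.30] -/
theorem integral_pow_gaussianReal_one_eq_gaussMoment (q : ℕ) :
    ∫ x, x ^ q ∂(gaussianReal 0 1) = gaussMoment q := by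
  rcases Nat.even_or_odd q with ⟨s, rfl⟩ | ⟨s, rfl⟩
  · rw [← two_mul, gaussMoment_even, integral_pow_even_gaussianReal_one]
  · rw [gaussMoment_odd]
    exact integral_pow_odd_gaussianReal 1 s

/-! ### The Rademacher embedding of a polynomial -/

variable {n : ℕ}

/-- The `i`-th embedded coordinate on the cube `{0,1}^{n k}`: the normalised Rademacher sum
`k^{-1/2} ∑_{j<k} (-1)^{x_{(i,j)}}` of the `i`-th block. [cite: Gross1975, §4] -/
def embedCoord (n k : ℕ) (x : Fin (n * k) → Bool) (i : Fin n) : ℝ :=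
  (∑ j : Fin k, sgn (x (finProdFinEquiv (i, j)))) / Real.sqrt k

/-- The pull-back of a polynomial `Q` to the cube `{0,1}^{n k}` along the embedded coordinates.
[cite: Gross1975, §4] -/
def embedEval (n k : ℕ) (Q : MvPolynomial (Fin n) ℝ) (x : Fin (n * k) → Bool) : ℝ :=
  MvPolynomial.eval (embedCoord n k x) Q

/-- A single sign is the singleton character: `(-1)^{x_l} = χ_{{l}}(x)`. [cite: ODonnell2014, §1.2] -/
theorem sgn_eq_walsh_singleton {m : ℕ} (l : Fin m) (x : Fin m → Bool) : sgn (x l) = walsh {l} x := by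
  simp [walsh]

/-- Each embedded coordinate has Fourier level `≤ 1`. [cite: ODonnell2014, §1.4] -/
theorem isLevelLE_embedCoord (n k : ℕ) (i : Fin n) : IsLevelLE 1 (fun x => embedCoord n k x i) := by
  unfold embedCoord
  have h : IsLevelLE 1 (fun x : Fin (n * k) → Bool => ∑ j : Fin k, sgn (x (finProdFinEquiv (i, j)))) := by
    refine IsLevelLE.sum _ fun j _ => ?_
    simp_rw [sgn_eq_walsh_singleton]
    exact isLevelLE_walsh _ (by simp)
  simpa [div_eq_inv_mul] using h.const_mul (Real.sqrt k)⁻¹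

/-- **The pulled-back polynomial is a low-degree function on the cube**: if `deg Q ≤ d` then
`embedEval n k Q` has Fourier level `≤ d`. [cite: ODonnell2014, §1.4] -/
theorem isLevelLE_embedEval (n k d : ℕ) (Q : MvPolynomial (Fin n) ℝ) (hQ : Q.totalDegree ≤ d) :
    IsLevelLE d (embedEval n k Q) := by
  have e : embedEval n k Q = fun x => ∑ α ∈ Q.support, Q.coeff α * ∏ i, embedCoord n k x i ^ α i := by
    funext x; exact MvPolynomial.eval_eq' _ _
  rw [e]
  refine IsLevelLE.sum _ fun α hα => IsLevelLE.const_mul _ ?_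
  have hprod : IsLevelLE (∑ i, α i * 1) (fun x => ∏ i, embedCoord n k x i ^ α i) :=
    IsLevelLE.prod univ fun i _ => (isLevelLE_embedCoord n k i).pow (α i)
  refine hprod.mono ?_
  have h1 : ∑ i, α i * 1 = α.sum fun _ e => e := by
    rw [Finsupp.sum_fintype _ _ fun _ => rfl]
    simp
  rw [h1]
  exact (MvPolynomial.le_totalDegree hα).trans hQ

/-- `embedEval` is a ring homomorphism in `Q`: powers. [folklore] -/
theorem embedEval_pow (n k : ℕ) (Q : MvPolynomial (Fin n) ℝ) (q : ℕ) (x : Fin (n * k) → Bool) :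
    embedEval n k (Q ^ q) x = embedEval n k Q x ^ q := by
  simp [embedEval]

/-! ### Cube averages of pulled-back polynomials factorise over the blocks -/

/-- The reindexing `{0,1}^{nk} ≃ ({0,1}^k)^n` of the cube into its `n` blocks. [folklore] -/
def blockEquiv (n k : ℕ) : (Fin (n * k) → Bool) ≃ (Fin n → Fin k → Bool) :=
  (finProdFinEquiv.symm.arrowCongr (Equiv.refl Bool)).trans (Equiv.curry _ _ _)

/-- In block coordinates the embedded coordinate is the normalised Rademacher sum of its block. [folklore] -/
theorem embedCoord_blockEquiv_symm (n k : ℕ) (y : Fin n → Fin k → Bool) (i : Fin n) :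
    embedCoord n k ((blockEquiv n k).symm y) i = radSum k (y i) / Real.sqrt k := by
  unfold embedCoord radSum blockEquiv
  congr 1
  refine sum_congr rfl fun j _ => ?_
  simp [Equiv.arrowCongr, Equiv.curry]

/-- **Block factorisation**: the cube average of the pull-back of `Q` is the polynomial's
"moment functional" evaluated at the Rademacher moments,
`𝔼_{cube} Q(X) = ∑_α Q_α ∏ᵢ 𝔼 (S_k/√k)^{αᵢ}`. [cite: Gross1975, §4] -/
theorem cubeAvg_embedEval (n k : ℕ) (Q : MvPolynomial (Fin n) ℝ) :
    (∑ x : Fin (n * k) → Bool, embedEval n k Q x) / 2 ^ (n * k) =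
      ∑ α ∈ Q.support, Q.coeff α * ∏ i, radMomentN k (α i) := by
  -- reindex the cube into blocks
  have hre : ∑ x : Fin (n * k) → Bool, embedEval n k Q x =
      ∑ y : Fin n → Fin k → Bool, embedEval n k Q ((blockEquiv n k).symm y) :=
    (Fintype.sum_equiv (blockEquiv n k).symm _ _ fun _ => rfl).symm
  rw [hre]
  simp only [embedEval, MvPolynomial.eval_eq', embedCoord_blockEquiv_symm]
  rw [sum_comm, sum_div]
  refine sum_congr rfl fun α _ => ?_
  rw [← mul_sum, mul_div_assoc]
  congr 1
  -- `∑_y ∏_i f_i(y_i) = ∏_i ∑_z f_i(z)`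
  have hps := Finset.prod_univ_sum (fun _ : Fin n => (univ : Finset (Fin k → Bool)))
    (fun i z => (radSum k z / Real.sqrt k) ^ α i)
  rw [Fintype.piFinset_univ] at hps
  rw [← hps]
  unfold radMomentN
  rw [prod_div_distrib, prod_const, card_univ, Fintype.card_fin, ← pow_mul, mul_comm k n]

/-! ### Gaussian integrals of polynomials -/

/-- Monomials are integrable under the standard Gaussian product measure. [folklore] -/
theorem integrable_monomial_pi_gaussianReal (α : Fin n →₀ ℕ) :
    Integrable (fun x : Fin n → ℝ => ∏ i, x i ^ α i) (Measure.pi fun _ : Fin n => gaussianReal 0 1) :=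
  Integrable.fintype_prod (f := fun i t => t ^ α i) fun i => integrable_pow_gaussianReal 0 1 (α i)

/-- Polynomials are integrable under the standard Gaussian product measure. [folklore] -/
theorem integrable_eval_pi_gaussianReal (Q : MvPolynomial (Fin n) ℝ) :
    Integrable (fun x : Fin n → ℝ => MvPolynomial.eval x Q) (Measure.pi fun _ : Fin n => gaussianReal 0 1) := by
  have e : (fun x : Fin n → ℝ => MvPolynomial.eval x Q) =
      fun x => ∑ α ∈ Q.support, Q.coeff α * ∏ i, x i ^ α i := by
    funext x; exact MvPolynomial.eval_eq' _ _
  rw [e]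
  exact integrable_finsetSum _ fun α _ => (integrable_monomial_pi_gaussianReal α).const_mul _

/-- **The Gaussian integral of a polynomial through its coefficients**:
`∫ Q dγₙ = ∑_α Q_α ∏ᵢ gaussMoment(αᵢ)`. [cite: Janson1997, Rem. 1.30] -/
theorem integral_eval_pi_gaussianReal (Q : MvPolynomial (Fin n) ℝ) :
    ∫ x, MvPolynomial.eval x Q ∂(Measure.pi fun _ : Fin n => gaussianReal 0 1) =
      ∑ α ∈ Q.support, Q.coeff α * ∏ i, gaussMoment (α i) := by
  have e : (fun x : Fin n → ℝ => MvPolynomial.eval x Q) =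
      fun x => ∑ α ∈ Q.support, Q.coeff α * ∏ i, x i ^ α i := by
    funext x; exact MvPolynomial.eval_eq' _ _
  rw [e, integral_finsetSum _ fun α _ => (integrable_monomial_pi_gaussianReal α).const_mul _]
  refine sum_congr rfl fun α _ => ?_
  rw [integral_const_mul]
  congr 1
  rw [integral_fintype_prod_eq_prod (f := fun i t => t ^ α i)]
  exact prod_congr rfl fun i _ => integral_pow_gaussianReal_one_eq_gaussMoment (α i)

/-! ### The moment central limit theorem for pulled-back polynomials -/

/-- **Cube averages of the pull-back converge to the Gaussian integral**:
`𝔼_{{0,1}^{nk}} Q(X^{(k)}) → ∫ Q dγₙ` as `k → ∞`. [cite: Gross1975, §4] -/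
theorem tendsto_cubeAvg_embedEval (Q : MvPolynomial (Fin n) ℝ) :
    Tendsto (fun k : ℕ => (∑ x : Fin (n * k) → Bool, embedEval n k Q x) / 2 ^ (n * k)) atTop
      (𝓝 (∫ x, MvPolynomial.eval x Q ∂(Measure.pi fun _ : Fin n => gaussianReal 0 1))) := by
  simp_rw [cubeAvg_embedEval]
  rw [integral_eval_pi_gaussianReal]
  refine tendsto_finsetSum _ fun α _ => Tendsto.const_mul _ ?_
  exact tendsto_finsetProd _ fun i _ => tendsto_radMomentN (α i)

/-! ### The hypercontractive (Bonami–Nelson–Gross) inequality -/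

/-- **Gaussian hypercontractivity for polynomials, even-moment form** (Nelson; Bonami–Gross): for a
real polynomial `P` in `n` variables of total degree `≤ d` and every `r ≥ 1`,
`∫ P^{2r} dγₙ ≤ (2r-1)^{rd} (∫ P² dγₙ)^r` under the standard Gaussian `γₙ = 𝒩(0,1)^{⊗n}`,
i.e. `‖P‖_{2r} ≤ (2r-1)^{d/2} ‖P‖₂`. [cite: Janson1997, Thm. 5.10] [cite: Gross1975, §4] [cite: Nelson1973] -/
theorem gaussian_bonami_pi (d : ℕ) (P : MvPolynomial (Fin n) ℝ) (hP : P.totalDegree ≤ d)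
    (r : ℕ) (hr : 1 ≤ r) :
    ∫ x, MvPolynomial.eval x P ^ (2 * r) ∂(Measure.pi fun _ : Fin n => gaussianReal 0 1) ≤
      (2 * r - 1 : ℝ) ^ (r * d) *
        (∫ x, MvPolynomial.eval x P ^ 2 ∂(Measure.pi fun _ : Fin n => gaussianReal 0 1)) ^ r := by
  -- the two sides as limits of cube averages
  have hL : Tendsto (fun k : ℕ => (∑ x : Fin (n * k) → Bool, embedEval n k (P ^ (2 * r)) x) / 2 ^ (n * k)) atTop
      (𝓝 (∫ x, MvPolynomial.eval x P ^ (2 * r) ∂(Measure.pi fun _ : Fin n => gaussianReal 0 1))) := by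
    simpa only [map_pow] using tendsto_cubeAvg_embedEval (n := n) (P ^ (2 * r))
  have hR : Tendsto (fun k : ℕ => (2 * r - 1 : ℝ) ^ (r * d) *
      ((∑ x : Fin (n * k) → Bool, embedEval n k (P ^ 2) x) / 2 ^ (n * k)) ^ r) atTop
      (𝓝 ((2 * r - 1 : ℝ) ^ (r * d) *
        (∫ x, MvPolynomial.eval x P ^ 2 ∂(Measure.pi fun _ : Fin n => gaussianReal 0 1)) ^ r)) := by
    have h := tendsto_cubeAvg_embedEval (n := n) (P ^ 2)
    simp only [map_pow] at h
    exact (h.pow r).const_mul _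
  refine le_of_tendsto_of_tendsto' hL hR fun k => ?_
  -- Bonami on the cube `{0,1}^{nk}` for the level-`≤ d` function `embedEval n k P`
  have hB := (isLevelLE_embedEval n k d P hP).bonami_even_moment r hr
  simp only [embedEval_pow, ← pow_mul] at hB ⊢
  exact hB

/-- **Gaussian hypercontractivity for polynomials** over an arbitrary finite index type `ι`:
`∫ P^{2r} dγ ≤ (2r-1)^{rd} (∫ P² dγ)^r` for `γ = 𝒩(0,1)^{⊗ι}` and `deg P ≤ d`. [cite: Janson1997, Thm. 5.10] [cite: Gross1975, §4] -/
theorem gaussian_bonami_pi' {ι : Type*} [Fintype ι] [DecidableEq ι] (d : ℕ) (P : MvPolynomial ι ℝ)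
    (hP : P.totalDegree ≤ d) (r : ℕ) (hr : 1 ≤ r) :
    ∫ x, MvPolynomial.eval x P ^ (2 * r) ∂(Measure.pi fun _ : ι => gaussianReal 0 1) ≤
      (2 * r - 1 : ℝ) ^ (r * d) *
        (∫ x, MvPolynomial.eval x P ^ 2 ∂(Measure.pi fun _ : ι => gaussianReal 0 1)) ^ r := by
  classical
  set e := Fintype.equivFin ι with he
  -- transport the polynomial to `Fin n` variables
  set P' : MvPolynomial (Fin (Fintype.card ι)) ℝ := MvPolynomial.rename e P with hP'
  have hdeg : P'.totalDegree ≤ d := (MvPolynomial.totalDegree_rename_le _ _).trans hP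
  -- the reindexing of `ℝ^ι` is measure preserving
  have hmp : MeasurePreserving (MeasurableEquiv.piCongrLeft (fun _ : ι => ℝ) e.symm)
      (Measure.pi fun _ : Fin (Fintype.card ι) => gaussianReal 0 1) (Measure.pi fun _ : ι => gaussianReal 0 1) :=
    measurePreserving_piCongrLeft (fun _ : ι => gaussianReal 0 1) e.symm
  have hev : ∀ y : Fin (Fintype.card ι) → ℝ,
      MvPolynomial.eval (MeasurableEquiv.piCongrLeft (fun _ : ι => ℝ) e.symm y) P = MvPolynomial.eval y P' := by
    intro y
    rw [hP', MvPolynomial.eval_rename]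
    have hy : ((MeasurableEquiv.piCongrLeft (fun _ : ι => ℝ) e.symm) y : ι → ℝ) = y ∘ e := by
      funext i
      simp [MeasurableEquiv.coe_piCongrLeft, Equiv.piCongrLeft_apply_eq_cast]
    rw [hy]
  have h2r : ∫ x, MvPolynomial.eval x P ^ (2 * r) ∂(Measure.pi fun _ : ι => gaussianReal 0 1) =
      ∫ y, MvPolynomial.eval y P' ^ (2 * r) ∂(Measure.pi fun _ : Fin (Fintype.card ι) => gaussianReal 0 1) := by
    rw [← hmp.integral_comp' (g := fun x => MvPolynomial.eval x P ^ (2 * r))]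
    simp_rw [hev]
  have h2 : ∫ x, MvPolynomial.eval x P ^ 2 ∂(Measure.pi fun _ : ι => gaussianReal 0 1) =
      ∫ y, MvPolynomial.eval y P' ^ 2 ∂(Measure.pi fun _ : Fin (Fintype.card ι) => gaussianReal 0 1) := by
    rw [← hmp.integral_comp' (g := fun x => MvPolynomial.eval x P ^ 2)]
    simp_rw [hev]
  rw [h2r, h2]
  exact gaussian_bonami_pi d P' hdeg r hr

/-! ### Linear images: arbitrary centred Gaussian vectors -/

section LinearImage

variable {ι κ : Type*} [Fintype ι]

/-- The linear substitution `X_a ↦ ∑ᵢ A_{a i} Xᵢ` as polynomials. [folklore] -/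
def linSubst (A : Matrix κ ι ℝ) (a : κ) : MvPolynomial ι ℝ := ∑ i, C (A a i) * X i

/-- Each substituted variable is a polynomial of degree `≤ 1`. [folklore] -/
theorem totalDegree_linSubst_le (A : Matrix κ ι ℝ) (a : κ) : (linSubst A a).totalDegree ≤ 1 := by
  unfold linSubst
  refine totalDegree_finsetSum_le fun i _ => (totalDegree_mul _ _).trans ?_
  rw [totalDegree_C, zero_add, totalDegree_X]

/-- Evaluating the substituted polynomial is evaluating at the linear image: `(P ∘ A)(z) = P(Az)`. [folklore] -/
theorem eval_bind₁_linSubst (A : Matrix κ ι ℝ) (P : MvPolynomial κ ℝ) (z : ι → ℝ) :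
    MvPolynomial.eval z (bind₁ (linSubst A) P) = MvPolynomial.eval (A *ᵥ z) P := by
  show eval₂Hom (RingHom.id ℝ) z (bind₁ (linSubst A) P) = _
  rw [eval₂Hom_bind₁]
  show MvPolynomial.eval (fun a => MvPolynomial.eval z (linSubst A a)) P = _
  have hfun : (fun a => MvPolynomial.eval z (linSubst A a)) = A *ᵥ z := by
    funext a
    simp [linSubst, Matrix.mulVec, dotProduct]
  rw [hfun]

/-- A linear substitution does not raise the total degree. [folklore] -/
theorem totalDegree_bind₁_linSubst_le (A : Matrix κ ι ℝ) (P : MvPolynomial κ ℝ) :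
    (bind₁ (linSubst A) P).totalDegree ≤ P.totalDegree := by
  classical
  conv_lhs => rw [P.as_sum]
  rw [map_sum]
  refine totalDegree_finsetSum_le fun α hα => ?_
  rw [bind₁_monomial]
  refine (totalDegree_mul _ _).trans ?_
  rw [totalDegree_C, zero_add]
  refine (totalDegree_finsetProd _ _).trans ?_
  calc ∑ i ∈ α.support, ((linSubst A i) ^ α i).totalDegree
      ≤ ∑ i ∈ α.support, α i := by
        refine sum_le_sum fun i _ => (totalDegree_pow _ _).trans ?_
        have := totalDegree_linSubst_le A i
        calc α i * (linSubst A i).totalDegree ≤ α i * 1 := Nat.mul_le_mul_left _ this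
          _ = α i := mul_one _
    _ = α.sum fun _ e => e := rfl
    _ ≤ P.totalDegree := le_totalDegree hα

/-- **Gaussian hypercontractivity for polynomials of an arbitrary centred Gaussian vector**
(linear image `Az` of a standard Gaussian `z`, covariance `AAᵀ` possibly singular):
`E P(Az)^{2r} ≤ (2r-1)^{rd} (E P(Az)²)^r` for `deg P ≤ d`. [cite: Janson1997, Thm. 5.10] [cite: Gross1975, §4] -/
theorem gaussian_bonami_mulVec [DecidableEq ι] [Fintype κ] [DecidableEq κ] (A : Matrix κ ι ℝ) (d : ℕ)
    (P : MvPolynomial κ ℝ) (hP : P.totalDegree ≤ d) (r : ℕ) (hr : 1 ≤ r) :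
    ∫ z, MvPolynomial.eval (A *ᵥ z) P ^ (2 * r) ∂(Measure.pi fun _ : ι => gaussianReal 0 1) ≤
      (2 * r - 1 : ℝ) ^ (r * d) *
        (∫ z, MvPolynomial.eval (A *ᵥ z) P ^ 2 ∂(Measure.pi fun _ : ι => gaussianReal 0 1)) ^ r := by
  have h := gaussian_bonami_pi' d (bind₁ (linSubst A) P) ((totalDegree_bind₁_linSubst_le A P).trans hP) r hr
  simpa only [eval_bind₁_linSubst] using h

end LinearImage

/-- **Gaussian hypercontractivity for polynomials under Mathlib's multivariate Gaussian**
`𝒩(0, S)` on `ℝ^ι` (any `S`; for `S ⪰ 0` this is the centred Gaussian vector of covariance `S`):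
`∫ P^{2r} d𝒩(0,S) ≤ (2r-1)^{rd} (∫ P² d𝒩(0,S))^r` for `deg P ≤ d`. [cite: Janson1997, Thm. 5.10] [cite: Gross1975, §4] -/
theorem gaussian_bonami_multivariateGaussian {ι : Type*} [Fintype ι] [DecidableEq ι] (S : Matrix ι ι ℝ)
    (d : ℕ) (P : MvPolynomial ι ℝ) (hP : P.totalDegree ≤ d) (r : ℕ) (hr : 1 ≤ r) :
    ∫ x, MvPolynomial.eval (WithLp.ofLp x) P ^ (2 * r) ∂(multivariateGaussian 0 S) ≤
      (2 * r - 1 : ℝ) ^ (r * d) *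
        (∫ x, MvPolynomial.eval (WithLp.ofLp x) P ^ 2 ∂(multivariateGaussian 0 S)) ^ r := by
  have key : ∀ q : ℕ, ∫ x, MvPolynomial.eval (WithLp.ofLp x) P ^ q ∂(multivariateGaussian 0 S) =
      ∫ z, MvPolynomial.eval (CFC.sqrt S *ᵥ z) P ^ q ∂(Measure.pi fun _ : ι => gaussianReal 0 1) := by
    intro q
    have hc : Continuous fun x : EuclideanSpace ℝ ι => MvPolynomial.eval (WithLp.ofLp x) P ^ q :=
      ((MvPolynomial.continuous_eval P).comp (PiLp.continuous_ofLp 2 _)).pow q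
    rw [multivariateGaussian, integral_map (by fun_prop) hc.aestronglyMeasurable]
    simp only [zero_add]
    rw [← map_pi_eq_stdGaussian, integral_map (by fun_prop)]
    · simp
    · exact (hc.comp (by fun_prop)).aestronglyMeasurable
  rw [key, key]
  exact gaussian_bonami_mulVec _ d P hP r hr

end Literature.Probability.Distributions

end
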